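import Literature.Computability.AlgebraicComplexity.FSV18Thm9AssemblyR1
import Literature.Computability.AlgebraicComplexity.Forbes15SmallSupportMonomials
import HarnessLib

/-!
# FSV 2018 Thm. 9 from FIVE external facts (Lemma 36 discharged)

M. A. Forbes, A. Shpilka, B. L. Volk, *Succinct hitting sets and barriers to proving lower bounds
for algebraic circuits*, ToC 14 (2018), Thm. 9 (= ToC Thm. 1.10).  The val-lit N1 assembly
`FSV2018_thm9_of_R1facts` (t18, `FSV18Thm9AssemblyR1`) takes six printed external results as
hypotheses; Lemma 36 [Forbes 2015, Prop. 6.5] is now a theorem (`FSV2018_lemma36_holds`,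
`Forbes15SmallSupportMonomials`), so five remain: Fact 19 [SS], Lemma 23 [BMS13/ASSS16],
Lemma 40 [FSS14 Thm. 4.1], Thm. 48 [ASSS16], Lemma 53 (∀ F).  Honest framing: sorry-free glue
between typed facts; VP ≠ VNP is not proved and nothing here is progress on it.
-/

namespace Literature.Computability.AlgebraicComplexity

/-- **FSV Thm. 9 (ToC Thm. 1.10) from five external facts** — `FSV2018_thm9_of_R1facts` with its
Lemma-36 hypothesis discharged by `FSV2018_lemma36_holds`.
[cite: ForbesShpilkaVolk2018, Thm. 9 (seq.) = ToC Thm. 1.10, pp. 14–15; Lemma 36 = ToC Lemma 5.12] -/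
theorem FSV2018_thm9_of_fiveFacts (h19 : FSV2018_fact19) (h23 : FSV2018_lemma23)
    (h40 : FSV2018_lemma40) (h48 : FSV2018_thm48)
    (h53 : ∀ (F : Type) [Field F], ForbesShpilkaVolk2018_lemma53 F) : FSV2018_thm9 :=
  FSV2018_thm9_of_R1facts h19 h23 FSV2018_lemma36_holds h40 h48 h53

end Literature.Computability.AlgebraicComplexity
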